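import Summits.ValiantsHypothesis.ValiantsHypothesis.Theorems.BarrierLeverAnchoredDoorHitsLowerPairsConjMReduction
import Summits.ValiantsHypothesis.ValiantsHypothesis.Theorems.BarrierLeverAnchoredDoorHitsLowerPairsSplitCalculus

/-!
# Support item `AnchoredDoorHitsLowerPairs` (stmt-ValiantsHypothesis-22510), line `anchored-peeling`:
# THE APEX LEMMA for Conjecture M — one apex vertex `x_n`, a tail set `(1 + x_n)`, and the door columns split into two families one dimension down

Helper file (`--supports stmt-ValiantsHypothesis-22510`; cell valiant-natproofs, rung V4, 𝒟-side door (c); registered line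
`Cruxes/AnchoredDoorHitsLowerPairs/Lines/anchored_peeling.lean` v16/v17, registered target `Stmt.stub_conjM`; prover seat val-np-p1 gen 21;
memo HOME/val-np-p1/g21/MEMO-conjM-LT-valnp1-g21.md §6). Closes NO item.

SETTING. Door elements `D_γ = doorElem θ φ γ` (file `…ConjMReduction`), one per column vertex `γ`; a FAMILY `F` of columns (vertex sets `W`), read on the
rows `x^U`, `U ⊆ X`. `IndepCols X F θ φ`: the columns `([x^U] ∏_{γ∈W} D_γ)_{U ⊆ X}`, `W ∈ F`, are linearly independent (stated with explicit finite sums).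

THE APEX SPECIALISATION (`apexTheta`, `apexPhi`). Variables `X = X' ⊔ {n}`; an apex vertex `v⋆` gets the door `x_n`; the vertices of a tail set `G₁` get the
`x_n`-tail of weight `1` on every root, `D_γ = D''_γ · (1 + x_n)`; all other doors are `x_n`-free (`D''_γ = doorElem θ'' φ''` with `θ'' n · = 0`, `φ'' · · n = 0`).
Then (`coeff_prod_doorElem_apex_notMem` / `_mem`): a column `W ∌ v⋆` reads `[x^U] D''^W` on `U ∌ n` and `|W ∩ G₁| · [x^{U∖n}] D''^W` on `U ∋ n`; a column
`W ∋ v⋆` reads `0` on `U ∌ n` and `[x^{U∖n}] D''^{W∖v⋆}` on `U ∋ n`.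

**THE APEX LEMMA (`indepCols_apex`).** Let `L = {W∖v⋆ : v⋆ ∈ W ∈ F}`, `F' = {W ∈ F : v⋆ ∉ W}` and let `T ⊆ F'` consist of columns meeting `G₁` and not in
`L`, such that every column of `F'` meeting `G₁` lies in `T` or in `L`. If the columns of `F' ∖ T` and those of `L ∪ T` are independent on the rows `2^{X'}`
(for the doors `D''`), then the columns of `F` are independent on the rows `2^{X' ⊔ n}` for the apex specialisation. (Proof: the `U ∋ n` equations are a
vanishing combination of the columns of `L ∪ T`; this kills the coefficients on `T`; then the `U ∌ n` equations are a vanishing combination of the columns of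
`F' ∖ T`; finally the `L`-coefficients vanish.) No lowerness, no profile condition, no counting is used; with `|F| = 2^{|X|}` and `|L ∪ T| = |F'∖T| = 2^{|X'|}`
this is the recursion «apex-decomposable ⟹ Conjecture M for that pair» of memo §6 (the generic-parameter packaging is the sequel file).

WHAT THIS IS NOT: no claim that every dominated complex is apex-decomposable (4 exceptions among the 950 six-vertex complexes at `|X| = 5` are known, memo §7);
nothing on crux stmt-ValiantsHypothesis-14610 or on `VP` versus `VNP`.
-/

set_option linter.dupNamespace false

namespace Summit.ValiantsHypothesis.ValiantsHypothesis.Theorems.BarrierLever.AnchoredPeeling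

open Finset MvPolynomial
open Summit.ValiantsHypothesis.ValiantsHypothesis.Theorems.BarrierLever.BrickCalculus (pexpo pexpo_def pexpo_le_iff pexpo_sub
  pexpo_apply_castAdd pexpo_apply_natAdd)

noncomputable section

variable {h : ℕ}

/-! ## 1. Square-free readings against one distinguished `x`-variable -/

/-- `pexpo {a} ∅` is the unit exponent of `x_a`. -/
theorem pexpo_singleton_empty (a : Fin h) : pexpo ({a} : Finset (Fin h)) ∅ = Finsupp.single (Fin.castAdd h a) 1 := by
  rw [pexpo_def, Finset.sum_singleton, Finset.sum_empty, add_zero]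

/-- `x_a` occurs in `x^U y^W` iff `a ∈ U`. -/
theorem castAdd_mem_support_pexpo_iff (U W : Finset (Fin h)) (a : Fin h) :
    Fin.castAdd h a ∈ (pexpo U W).support ↔ a ∈ U := by
  rw [Finsupp.mem_support_iff, pexpo_apply_castAdd]
  by_cases ha : a ∈ U <;> simp [ha]

/-- Reading `x_a · P`: `[x^U y^W] (x_a P) = [a ∈ U] · [x^{U∖a} y^W] P`. -/
theorem coeff_pexpo_X_mul (a : Fin h) (P : MvPolynomial (Fin (h + h)) ℂ) (U W : Finset (Fin h)) :
    coeff (pexpo U W) (X (Fin.castAdd h a) * P) = if a ∈ U then coeff (pexpo (U.erase a) W) P else 0 := by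
  classical
  rw [coeff_X_mul']
  by_cases ha : a ∈ U
  · rw [if_pos ((castAdd_mem_support_pexpo_iff U W a).mpr ha), if_pos ha, ← pexpo_singleton_empty,
      pexpo_sub _ _ _ _ (Finset.singleton_subset_iff.mpr ha) (Finset.empty_subset _), Finset.sdiff_empty,
      Finset.sdiff_singleton_eq_erase]
  · rw [if_neg (fun hmem => ha ((castAdd_mem_support_pexpo_iff U W a).mp hmem)), if_neg ha]

/-- `∏_{γ ∈ W} (1 + c_γ x_a) = 1 + (Σ c_γ) x_a + x_a² · r`. -/
theorem prod_one_add_C_mul_X_single (a : Fin h) (c : Fin h → ℂ) (W : Finset (Fin h)) :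
    ∃ r : MvPolynomial (Fin (h + h)) ℂ,
      ∏ γ ∈ W, (1 + C (c γ) * X (Fin.castAdd h a)) = 1 + C (∑ γ ∈ W, c γ) * X (Fin.castAdd h a) + X (Fin.castAdd h a) ^ 2 * r := by
  classical
  induction W using Finset.induction_on with
  | empty => exact ⟨0, by simp⟩
  | insert γ W hγ ih =>
    obtain ⟨r, hr⟩ := ih
    refine ⟨r * (1 + C (c γ) * X (Fin.castAdd h a)) + C (∑ γ' ∈ W, c γ') * C (c γ), ?_⟩
    rw [Finset.prod_insert hγ, Finset.sum_insert hγ, hr, C_add]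
    ring

/-- `P` is free of the variable `x_a`. -/
def XFree (a : Fin h) (P : MvPolynomial (Fin (h + h)) ℂ) : Prop :=
  ThinStep.killVars {Fin.castAdd h a} P = P

/-- An `x_a`-free polynomial has no readings on faces containing `a`. -/
theorem coeff_pexpo_eq_zero_of_xFree {a : Fin h} {P : MvPolynomial (Fin (h + h)) ℂ} (hP : XFree a P) {U : Finset (Fin h)} (W : Finset (Fin h))
    (ha : a ∈ U) : coeff (pexpo U W) P = 0 := by
  classical
  rw [← hP]
  refine ThinStep.coeff_killVars_of_not_disjoint _ _ (fun hdis => ?_)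
  exact Finset.disjoint_left.mp hdis ((castAdd_mem_support_pexpo_iff U W a).mpr ha) (Finset.mem_singleton_self _)

/-- Products of `x_a`-free polynomials are `x_a`-free. -/
theorem xFree_prod {a : Fin h} {ι : Type*} (s : Finset ι) (P : ι → MvPolynomial (Fin (h + h)) ℂ) (hP : ∀ i ∈ s, XFree a (P i)) :
    XFree a (∏ i ∈ s, P i) := by
  rw [XFree, map_prod]
  exact Finset.prod_congr rfl (fun i hi => hP i hi)

/-- **Reading an `x_a`-free polynomial times a product of `x_a`-tails.**
`[x^U] (P · ∏_{γ∈W} (1 + c_γ x_a)) = [a ∉ U]·[x^U] P + [a ∈ U]·(Σ_{γ∈W} c_γ)·[x^{U∖a}] P`. -/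
theorem coeff_pexpo_mul_prod_tails {a : Fin h} {P : MvPolynomial (Fin (h + h)) ℂ} (hP : XFree a P) (c : Fin h → ℂ) (W U : Finset (Fin h)) :
    coeff (pexpo U ∅) (P * ∏ γ ∈ W, (1 + C (c γ) * X (Fin.castAdd h a))) =
      if a ∈ U then (∑ γ ∈ W, c γ) * coeff (pexpo (U.erase a) ∅) P else coeff (pexpo U ∅) P := by
  classical
  obtain ⟨r, hr⟩ := prod_one_add_C_mul_X_single a c W
  rw [hr, mul_add, mul_add, mul_one, coeff_add, coeff_add]
  have h2 : coeff (pexpo U ∅) (P * (X (Fin.castAdd h a) ^ 2 * r)) = 0 := by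
    rw [mul_left_comm, coeff_pexpo_X_sq_mul U ∅ (Fin.castAdd h a) (P * r)]
  have h1 : coeff (pexpo U ∅) (P * (C (∑ γ ∈ W, c γ) * X (Fin.castAdd h a))) =
      if a ∈ U then (∑ γ ∈ W, c γ) * coeff (pexpo (U.erase a) ∅) P else 0 := by
    rw [show P * (C (∑ γ ∈ W, c γ) * X (Fin.castAdd h a)) = C (∑ γ ∈ W, c γ) * (X (Fin.castAdd h a) * P) by ring,
      coeff_C_mul, coeff_pexpo_X_mul]
    split_ifs <;> simp
  rw [h2, add_zero, h1]
  by_cases ha : a ∈ U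
  · rw [if_pos ha, if_pos ha, coeff_pexpo_eq_zero_of_xFree hP ∅ ha, zero_add]
  · rw [if_neg ha, if_neg ha, add_zero]

/-! ## 2. The apex specialisation of the doors -/

section Apex

variable (θ'' : Fin h → Fin h → ℂ) (φ'' : Fin h → Fin h → Fin h → ℂ) (vs n : Fin h) (G₁ : Finset (Fin h))

/-- Apex root weights: the apex `v⋆` has the single root `n` (weight `1`); every other vertex keeps its roots off `n`. -/
def apexTheta : Fin h → Fin h → ℂ :=
  fun b γ => if γ = vs then (if b = n then 1 else 0) else (if b = n then 0 else θ'' b γ)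

/-- Apex tail weights: the apex has no tails; a vertex of `G₁` gets the `x_n`-tail `1` on every root; other tails at `n` are `0`. -/
def apexPhi : Fin h → Fin h → Fin h → ℂ :=
  fun b γ b' => if γ = vs then 0 else (if b' = n then (if γ ∈ G₁ then 1 else 0) else φ'' b γ b')

/-- The tail indicator `c_γ = [γ ∈ G₁]`. -/
def tailInd : Fin h → ℂ := fun γ => if γ ∈ G₁ then 1 else 0

variable {θ'' φ'' vs n G₁}

/-- **The apex door is `x_n`.** -/
theorem doorElem_apex_self : doorElem (apexTheta θ'' vs n) (apexPhi φ'' vs n G₁) vs = X (Fin.castAdd h n) := by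
  classical
  rw [doorElem, Finset.sum_eq_single n]
  · rw [cfacCore]
    simp only [apexTheta, apexPhi, if_true, C_1, C_0, zero_mul, add_zero, Finset.prod_const_one, mul_one]
    rw [pexpo_singleton_empty]; rfl
  · intro b _ hb
    rw [cfacCore]
    simp only [apexTheta, if_true, if_neg hb, C_0, zero_mul, mul_zero]
  · intro hn; exact absurd (Finset.mem_univ n) hn

/-- Core factors off the apex: `cfacCore(spec) b = cfacCore('') b · (1 + c_γ x_n)` when `θ'' n γ = 0` and `φ'' b γ n = 0`. -/
theorem cfacCore_apex_of_ne {γ : Fin h} (hγ : γ ≠ vs) (hθ : θ'' n γ = 0) (hφ : ∀ b, φ'' b γ n = 0) (b : Fin h) :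
    cfacCore (fun b => apexTheta θ'' vs n b γ) (fun b b' => apexPhi φ'' vs n G₁ b γ b') b =
      cfacCore (fun b => θ'' b γ) (fun b b' => φ'' b γ b') b * (1 + C (tailInd G₁ γ) * X (Fin.castAdd h n)) := by
  classical
  by_cases hb : b = n
  · subst hb
    rw [cfacCore, cfacCore]
    simp only [apexTheta, if_neg hγ, if_true, hθ, C_0, zero_mul, mul_zero]
  · rw [cfacCore, cfacCore]
    have hsplit : ∀ (ψ : Fin h → ℂ), (∏ b' ∈ (univ \ {b} : Finset (Fin h)), (1 + C (ψ b') * X (Fin.castAdd h b')) : MvPolynomial (Fin (h + h)) ℂ) =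
        (1 + C (ψ n) * X (Fin.castAdd h n)) * ∏ b' ∈ ((univ \ {b} : Finset (Fin h))).erase n, (1 + C (ψ b') * X (Fin.castAdd h b')) := by
      intro ψ
      have hn : n ∈ (univ \ {b} : Finset (Fin h)) := by
        rw [Finset.mem_sdiff, Finset.mem_singleton]; exact ⟨Finset.mem_univ n, fun h' => hb h'.symm⟩
      exact (Finset.mul_prod_erase _ _ hn).symm
    rw [hsplit (fun b' => apexPhi φ'' vs n G₁ b γ b'), hsplit (fun b' => φ'' b γ b')]
    have hrest : (∏ b' ∈ ((univ \ {b} : Finset (Fin h))).erase n, (1 + C (apexPhi φ'' vs n G₁ b γ b') * X (Fin.castAdd h b')) :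
        MvPolynomial (Fin (h + h)) ℂ) = ∏ b' ∈ ((univ \ {b} : Finset (Fin h))).erase n, (1 + C (φ'' b γ b') * X (Fin.castAdd h b')) :=
      Finset.prod_congr rfl (fun b' hb' => by
        rw [apexPhi]; simp only [if_neg hγ, if_neg (Finset.ne_of_mem_erase hb')])
    rw [hrest]
    simp only [apexTheta, apexPhi, tailInd, if_neg hγ, if_neg hb, if_true, hφ b, C_0, zero_mul, add_zero, one_mul]
    ring

/-- **Doors off the apex factor as `D''_γ · (1 + c_γ x_n)`.** -/
theorem doorElem_apex_of_ne {γ : Fin h} (hγ : γ ≠ vs) (hθ : θ'' n γ = 0) (hφ : ∀ b, φ'' b γ n = 0) :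
    doorElem (apexTheta θ'' vs n) (apexPhi φ'' vs n G₁) γ = doorElem θ'' φ'' γ * (1 + C (tailInd G₁ γ) * X (Fin.castAdd h n)) := by
  rw [doorElem, doorElem, Finset.sum_mul]
  exact Finset.sum_congr rfl (fun b _ => cfacCore_apex_of_ne hγ hθ hφ b)

/-- An `x_n`-rootless, `x_n`-tailless door is `x_n`-free. -/
theorem xFree_doorElem {γ : Fin h} (hθ : θ'' n γ = 0) (hφ : ∀ b, φ'' b γ n = 0) : XFree n (doorElem θ'' φ'' γ) := by
  classical
  rw [XFree, doorElem, map_sum]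
  refine Finset.sum_congr rfl (fun b _ => ?_)
  by_cases hb : b = n
  · subst hb
    rw [cfacCore]; simp only [hθ, zero_mul, mul_zero, map_zero]
  · rw [cfacCore, map_mul, map_mul, map_prod, ThinStep.killVars_C, pexpo_singleton_empty, ← X, ThinStep.killVars_X,
      if_neg (fun hmem => hb (Fin.castAdd_inj.mp (Finset.mem_singleton.mp hmem)))]
    congr 2
    refine Finset.prod_congr rfl (fun b' _ => ?_)
    rw [map_add, map_one, map_mul, ThinStep.killVars_C, ThinStep.killVars_X]
    by_cases hb' : b' = n
    · subst hb'; simp [hφ b]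
    · rw [if_neg (fun hmem => hb' (Fin.castAdd_inj.mp (Finset.mem_singleton.mp hmem)))]

/-- **Column of a family member avoiding the apex.** -/
theorem coeff_prod_doorElem_apex_notMem {W : Finset (Fin h)} (hW : vs ∉ W) (hθ : ∀ γ, θ'' n γ = 0) (hφ : ∀ b γ, φ'' b γ n = 0)
    (U : Finset (Fin h)) :
    coeff (pexpo U ∅) (∏ γ ∈ W, doorElem (apexTheta θ'' vs n) (apexPhi φ'' vs n G₁) γ) =
      if n ∈ U then (∑ γ ∈ W, tailInd G₁ γ) * coeff (pexpo (U.erase n) ∅) (∏ γ ∈ W, doorElem θ'' φ'' γ)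
      else coeff (pexpo U ∅) (∏ γ ∈ W, doorElem θ'' φ'' γ) := by
  have hprod : ∏ γ ∈ W, doorElem (apexTheta θ'' vs n) (apexPhi φ'' vs n G₁) γ =
      (∏ γ ∈ W, doorElem θ'' φ'' γ) * ∏ γ ∈ W, (1 + C (tailInd G₁ γ) * X (Fin.castAdd h n)) := by
    rw [← Finset.prod_mul_distrib]
    exact Finset.prod_congr rfl (fun γ hγ => doorElem_apex_of_ne (fun heq => hW (heq ▸ hγ)) (hθ γ) (fun b => hφ b γ))
  rw [hprod, coeff_pexpo_mul_prod_tails (xFree_prod W _ (fun γ _ => xFree_doorElem (hθ γ) (fun b => hφ b γ)))]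

/-- **Column of a family member through the apex.** -/
theorem coeff_prod_doorElem_apex_mem {W : Finset (Fin h)} (hW : vs ∈ W) (hθ : ∀ γ, θ'' n γ = 0) (hφ : ∀ b γ, φ'' b γ n = 0)
    (U : Finset (Fin h)) :
    coeff (pexpo U ∅) (∏ γ ∈ W, doorElem (apexTheta θ'' vs n) (apexPhi φ'' vs n G₁) γ) =
      if n ∈ U then coeff (pexpo (U.erase n) ∅) (∏ γ ∈ W.erase vs, doorElem θ'' φ'' γ) else 0 := by
  classical
  rw [← Finset.mul_prod_erase W _ hW, doorElem_apex_self, coeff_pexpo_X_mul]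
  by_cases hn : n ∈ U
  · rw [if_pos hn, if_pos hn, coeff_prod_doorElem_apex_notMem (Finset.notMem_erase vs W) hθ hφ, if_neg (Finset.notMem_erase n U)]
  · rw [if_neg hn, if_neg hn]

end Apex

/-! ## 3. Independence of door columns and the Apex Lemma -/

/-- **Linear independence of the door columns of `F` on the rows `2^X`** (finite-sum form): every vanishing linear combination of the column vectors
`U ↦ [x^U] ∏_{γ∈W} D_γ` (`U ⊆ X`), `W ∈ F`, is trivial. -/
def IndepCols (X : Finset (Fin h)) (F : Finset (Finset (Fin h))) (θ : Fin h → Fin h → ℂ) (φ : Fin h → Fin h → Fin h → ℂ) : Prop :=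
  ∀ g : Finset (Fin h) → ℂ,
    (∀ U : Finset (Fin h), U ⊆ X → ∑ W ∈ F, g W * coeff (pexpo U ∅) (∏ γ ∈ W, doorElem θ φ γ) = 0) → ∀ W ∈ F, g W = 0

/-- **THE APEX LEMMA.** See the file header. `T` = the columns avoiding the apex, meeting the tail set, and not in the link; `F' ∖ T` and `L ∪ T` independent one
dimension down ⟹ `F` independent for the apex specialisation. -/
theorem indepCols_apex {X' : Finset (Fin h)} {n vs : Fin h} (hn : n ∉ X') (F : Finset (Finset (Fin h))) (G₁ : Finset (Fin h))
    (T : Finset (Finset (Fin h)))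
    (hTF : ∀ Y ∈ T, Y ∈ F ∧ vs ∉ Y) (hTG : ∀ Y ∈ T, (∑ γ ∈ Y, tailInd G₁ γ) ≠ 0) (hTL : ∀ Y ∈ T, insert vs Y ∉ F)
    (hcov : ∀ Y ∈ F, vs ∉ Y → (∑ γ ∈ Y, tailInd G₁ γ) ≠ 0 → Y ∈ T ∨ insert vs Y ∈ F)
    {θ'' : Fin h → Fin h → ℂ} {φ'' : Fin h → Fin h → Fin h → ℂ} (hθ : ∀ γ, θ'' n γ = 0) (hφ : ∀ b γ, φ'' b γ n = 0)
    (h0 : IndepCols X' ((F.filter (fun W => vs ∉ W)) \ T) θ'' φ'')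
    (h1 : IndepCols X' (((F.filter (fun W => vs ∈ W)).image (fun W => W.erase vs)) ∪ T) θ'' φ'') :
    IndepCols (insert n X') F (apexTheta θ'' vs n) (apexPhi φ'' vs n G₁) := by
  classical
  intro g hg
  set F' := F.filter (fun W => vs ∉ W) with hF'
  set L := (F.filter (fun W => vs ∈ W)).image (fun W => W.erase vs) with hL
  set c : Finset (Fin h) → ℂ := fun Y => ∑ γ ∈ Y, tailInd G₁ γ with hc
  set t : Finset (Fin h) → Finset (Fin h) → ℂ := fun Y U => coeff (pexpo U ∅) (∏ γ ∈ Y, doorElem θ'' φ'' γ) with ht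
  -- membership bookkeeping
  have hLmem : ∀ Y, Y ∈ L ↔ vs ∉ Y ∧ insert vs Y ∈ F := by
    intro Y
    rw [hL, Finset.mem_image]
    constructor
    · rintro ⟨W, hW, rfl⟩
      rw [Finset.mem_filter] at hW
      exact ⟨Finset.notMem_erase vs W, by rw [Finset.insert_erase hW.2]; exact hW.1⟩
    · rintro ⟨hvs, hins⟩
      exact ⟨insert vs Y, Finset.mem_filter.mpr ⟨hins, Finset.mem_insert_self vs Y⟩, Finset.erase_insert hvs⟩
  have hF'mem : ∀ Y, Y ∈ F' ↔ Y ∈ F ∧ vs ∉ Y := fun Y => by rw [hF', Finset.mem_filter]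
  have hTL' : ∀ Y ∈ T, Y ∉ L := fun Y hY hYL => hTL Y hY ((hLmem Y).mp hYL).2
  -- split the vanishing combination over F = F' ⊔ (faces through vs)
  have hsplit : ∀ U, ∑ W ∈ F, g W * coeff (pexpo U ∅) (∏ γ ∈ W, doorElem (apexTheta θ'' vs n) (apexPhi φ'' vs n G₁) γ) =
      ∑ W ∈ F', g W * coeff (pexpo U ∅) (∏ γ ∈ W, doorElem (apexTheta θ'' vs n) (apexPhi φ'' vs n G₁) γ) +
      ∑ W ∈ F.filter (fun W => vs ∈ W), g W * coeff (pexpo U ∅) (∏ γ ∈ W, doorElem (apexTheta θ'' vs n) (apexPhi φ'' vs n G₁) γ) := by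
    intro U
    rw [hF', ← Finset.sum_filter_add_sum_filter_not F (fun W => vs ∉ W)]
    congr 1
    exact Finset.sum_congr (Finset.filter_congr (fun W _ => by rw [not_not])) (fun _ _ => rfl)
  -- (bottom) rows `insert n U₀`, `U₀ ⊆ X'`: a vanishing combination of the columns of L ∪ T
  have hbot : ∀ U₀, U₀ ⊆ X' →
      ∑ Y ∈ L ∪ T, ((if Y ∈ F' then g Y * c Y else 0) + (if Y ∈ L then g (insert vs Y) else 0)) * t Y U₀ = 0 := by
    intro U₀ hU₀
    have hnU₀ : n ∉ U₀ := fun hmem => hn (hU₀ hmem)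
    have hU : insert n U₀ ⊆ insert n X' := Finset.insert_subset_insert n hU₀
    have herase : (insert n U₀).erase n = U₀ := Finset.erase_insert hnU₀
    have key := hg (insert n U₀) hU
    rw [hsplit] at key
    -- first block: W ∈ F'
    have hA : ∑ W ∈ F', g W * coeff (pexpo (insert n U₀) ∅) (∏ γ ∈ W, doorElem (apexTheta θ'' vs n) (apexPhi φ'' vs n G₁) γ) =
        ∑ W ∈ F', g W * c W * t W U₀ := by
      refine Finset.sum_congr rfl (fun W hW => ?_)
      rw [coeff_prod_doorElem_apex_notMem ((hF'mem W).mp hW).2 hθ hφ, if_pos (Finset.mem_insert_self n U₀), herase, mul_assoc]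
    -- second block: W ∋ vs, reindexed by Y = W.erase vs ∈ L
    have hB : ∑ W ∈ F.filter (fun W => vs ∈ W), g W * coeff (pexpo (insert n U₀) ∅)
        (∏ γ ∈ W, doorElem (apexTheta θ'' vs n) (apexPhi φ'' vs n G₁) γ) = ∑ Y ∈ L, g (insert vs Y) * t Y U₀ := by
      rw [hL, Finset.sum_image]
      · refine Finset.sum_congr rfl (fun W hW => ?_)
        have hvsW : vs ∈ W := (Finset.mem_filter.mp hW).2
        rw [coeff_prod_doorElem_apex_mem hvsW hθ hφ, if_pos (Finset.mem_insert_self n U₀), herase, Finset.insert_erase hvsW]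
      · intro W hW W' hW' heq
        have h1 : vs ∈ W := (Finset.mem_filter.mp hW).2
        have h2 : vs ∈ W' := (Finset.mem_filter.mp hW').2
        have heq' : W.erase vs = W'.erase vs := heq
        rw [← Finset.insert_erase h1, ← Finset.insert_erase h2, heq']
    rw [hA, hB] at key
    -- regroup over L ∪ T
    rw [Finset.sum_union (Finset.disjoint_left.mpr (fun Y hYL hYT => hTL' Y hYT hYL)) ] at *
    have hsumF' : ∑ W ∈ F', g W * c W * t W U₀ = ∑ Y ∈ T, g Y * c Y * t Y U₀ + ∑ Y ∈ L, (if Y ∈ F' then g Y * c Y else 0) * t Y U₀ := by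
      -- terms of F' with c ≠ 0 lie in T ⊔ (L ∩ F')
      have hTsub : T ⊆ F' := fun Y hY => (hF'mem Y).mpr (hTF Y hY)
      rw [← Finset.sum_sdiff hTsub, add_comm]
      congr 1
      -- Σ over F' \ T equals Σ over L of the indicator-weighted terms
      rw [← Finset.sum_filter_add_sum_filter_not (F' \ T) (fun Y => Y ∈ L)]
      have hz : ∑ Y ∈ (F' \ T).filter (fun Y => Y ∉ L), g Y * c Y * t Y U₀ = 0 := by
        refine Finset.sum_eq_zero (fun Y hY => ?_)
        obtain ⟨hY1, hY2⟩ := Finset.mem_filter.mp hY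
        obtain ⟨hYF', hYT⟩ := Finset.mem_sdiff.mp hY1
        have hcz : c Y = 0 := by
          by_contra hne
          rcases hcov Y ((hF'mem Y).mp hYF').1 ((hF'mem Y).mp hYF').2 hne with h' | h'
          · exact hYT h'
          · exact hY2 ((hLmem Y).mpr ⟨((hF'mem Y).mp hYF').2, h'⟩)
        rw [hcz, mul_zero, zero_mul]
      rw [hz, add_zero]
      rw [← Finset.sum_filter_add_sum_filter_not L (fun Y => Y ∈ F')]
      have hz2 : ∑ Y ∈ L.filter (fun Y => Y ∉ F'), (if Y ∈ F' then g Y * c Y else 0) * t Y U₀ = 0 :=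
        Finset.sum_eq_zero (fun Y hY => by rw [if_neg (Finset.mem_filter.mp hY).2, zero_mul])
      rw [hz2, add_zero]
      have hsets : (F' \ T).filter (fun Y => Y ∈ L) = L.filter (fun Y => Y ∈ F') := by
        ext Y
        simp only [Finset.mem_filter, Finset.mem_sdiff]
        constructor
        · rintro ⟨⟨hYF', -⟩, hYL⟩; exact ⟨hYL, hYF'⟩
        · rintro ⟨hYL, hYF'⟩; exact ⟨⟨hYF', fun hYT => hTL' Y hYT hYL⟩, hYL⟩
      rw [hsets]
      exact Finset.sum_congr rfl (fun Y hY => by rw [if_pos (Finset.mem_filter.mp hY).2])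
    rw [hsumF', add_assoc, ← Finset.sum_add_distrib] at key
    -- assemble
    have hTpart : ∑ Y ∈ T, ((if Y ∈ F' then g Y * c Y else 0) + (if Y ∈ L then g (insert vs Y) else 0)) * t Y U₀ = ∑ Y ∈ T, g Y * c Y * t Y U₀ :=
      Finset.sum_congr rfl (fun Y hY => by
        rw [if_pos ((hF'mem Y).mpr (hTF Y hY)), if_neg (hTL' Y hY), add_zero])
    have hLpart : ∑ Y ∈ L, ((if Y ∈ F' then g Y * c Y else 0) + (if Y ∈ L then g (insert vs Y) else 0)) * t Y U₀ =
        ∑ Y ∈ L, ((if Y ∈ F' then g Y * c Y else 0) * t Y U₀ + g (insert vs Y) * t Y U₀) :=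
      Finset.sum_congr rfl (fun Y hY => by rw [if_pos hY, add_mul])
    rw [hLpart, hTpart]
    linear_combination key
  -- apply independence of L ∪ T
  have hzero1 := h1 (fun Y => (if Y ∈ F' then g Y * c Y else 0) + (if Y ∈ L then g (insert vs Y) else 0)) hbot
  -- coefficients on T vanish
  have hgT : ∀ Y ∈ T, g Y = 0 := by
    intro Y hY
    have := hzero1 Y (Finset.mem_union_right _ hY)
    rw [if_pos ((hF'mem Y).mpr (hTF Y hY)), if_neg (hTL' Y hY), add_zero] at this
    rcases mul_eq_zero.mp this with h' | h'
    · exact h'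
    · exact absurd h' (hTG Y hY)
  -- (top) rows U ⊆ X': a vanishing combination of the columns of F' \ T
  have htop : ∀ U, U ⊆ X' → ∑ W ∈ F' \ T, g W * t W U = 0 := by
    intro U hU
    have hnU : n ∉ U := fun hmem => hn (hU hmem)
    have key := hg U (hU.trans (Finset.subset_insert n X'))
    rw [hsplit] at key
    have hB : ∑ W ∈ F.filter (fun W => vs ∈ W), g W * coeff (pexpo U ∅)
        (∏ γ ∈ W, doorElem (apexTheta θ'' vs n) (apexPhi φ'' vs n G₁) γ) = 0 :=
      Finset.sum_eq_zero (fun W hW => by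
        rw [coeff_prod_doorElem_apex_mem (Finset.mem_filter.mp hW).2 hθ hφ, if_neg hnU, mul_zero])
    rw [hB, add_zero] at key
    have hA : ∑ W ∈ F', g W * coeff (pexpo U ∅) (∏ γ ∈ W, doorElem (apexTheta θ'' vs n) (apexPhi φ'' vs n G₁) γ) =
        ∑ W ∈ F', g W * t W U :=
      Finset.sum_congr rfl (fun W hW => by rw [coeff_prod_doorElem_apex_notMem ((hF'mem W).mp hW).2 hθ hφ, if_neg hnU])
    rw [hA] at key
    have hTsub : T ⊆ F' := fun Y hY => (hF'mem Y).mpr (hTF Y hY)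
    have hT0 : ∑ Y ∈ T, g Y * t Y U = 0 := Finset.sum_eq_zero (fun Y hY => by rw [hgT Y hY, zero_mul])
    rw [← Finset.sum_sdiff hTsub, hT0, add_zero] at key
    exact key
  have hzero0 := h0 g htop
  -- conclude
  intro W hW
  by_cases hvsW : vs ∈ W
  · have hYL : W.erase vs ∈ L := (hLmem _).mpr ⟨Finset.notMem_erase vs W, by rw [Finset.insert_erase hvsW]; exact hW⟩
    have := hzero1 (W.erase vs) (Finset.mem_union_left _ hYL)
    have hY0 : (if W.erase vs ∈ F' then g (W.erase vs) * c (W.erase vs) else 0) = 0 := by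
      by_cases hYF' : W.erase vs ∈ F'
      · rw [if_pos hYF']
        by_cases hYT : W.erase vs ∈ T
        · rw [hgT _ hYT, zero_mul]
        · rw [hzero0 _ (Finset.mem_sdiff.mpr ⟨hYF', hYT⟩), zero_mul]
      · rw [if_neg hYF']
    rw [hY0, zero_add, if_pos hYL, Finset.insert_erase hvsW] at this
    exact this
  · have hWF' : W ∈ F' := (hF'mem W).mpr ⟨hW, hvsW⟩
    by_cases hWT : W ∈ T
    · exact hgT W hWT
    · exact hzero0 W (Finset.mem_sdiff.mpr ⟨hWF', hWT⟩)

end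

end Summit.ValiantsHypothesis.ValiantsHypothesis.Theorems.BarrierLever.AnchoredPeeling
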